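import Summits.Parity.GeneralizedHardyLittlewood.Theses.LiouvilleMAD
import Summits.Parity.GeneralizedHardyLittlewood.Theorems.LiouvilleShiftedTablesMAvgOfLevel
import Summits.Parity.GeneralizedHardyLittlewood.Theorems.LiouvilleShiftedTablesEngineToPairsDefs

/-!
# Sketch — crux-ideate stmt-Parity-14995 (`EngineToGHL`, route LiouvilleMAD), ideator 2, round 1

`EngineToGHL := g₁ ∧ g₂ ∧ g₃ ∧ g₄ ∧ r` with `g₁…g₄` DEFINITIONALLY the support items
`DecorrelationToDilatedChowla`, `DilatedChowlaToTypeII`, `TypeIIToLevel`, `LevelToPairs` and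
`r` DEFINITIONALLY the shared residual `LiouvilleShiftedTables.PairsToGHL` (stmt-Parity-9389).

* §0 structure (`Iff.rfl`).
* §1 card `hinge-rails-subsumption`: the ADAPTER `hingeHyp_of_level` — `LambdaLiouvilleLevel` at the
  shift `−h` (residue `w_q = h`, height `y_q = ⌊X⌋₊`) is the hypothesis of the tree theorem
  `MAvg.MAvg_of_sum_abs_vonMangoldt_mul_liouville_progressions_le`; hence `levelToMAvg :
  LambdaLiouvilleLevel → MAvg` and `levelToPairs_of_rails : PairsFromMAvg → LevelToPairs`
  (conjunct 4 of the crux from the sibling item stmt-Parity-14275, EH by `Iff.rfl`).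
* §2 card `class-blind-vaughan-dichotomy`: the class-blind Type-II statement `ClassTypeII`, the
  abstract orthogonality lemma behind it (`classBlind_abstract`, PROVED) and the card's first lemma
  `classTypeII_of_typeII : TypeIILiouville → ClassTypeII` (PROVED: unit classes of the product are
  free in the route's q-free Type-II node).
* §3 the whole crux modulo the named residual: `engineToGHL_of_rails`.
-/

noncomputable section

namespace Summit.Parity.GeneralizedHardyLittlewood.Cruxes.EngineToGHL.Ideator2

open Finset Real
open scoped ArithmeticFunction.vonMangoldt
open ArithmeticFunction (liouville)
open Summit.Parity.GeneralizedHardyLittlewood.Theses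
open Summit.Parity.GeneralizedHardyLittlewood.Theses.LiouvilleMAD

/-! ## §0 Structure -/

/-- The crux is the conjunction of the four support items and the shared residual `PairsToGHL`
(stmt-Parity-9389) — by `Iff.rfl`. -/
theorem engineToGHL_iff :
    EngineToGHL ↔ (DecorrelationToDilatedChowla ∧ DilatedChowlaToTypeII ∧ TypeIIToLevel ∧
      LevelToPairs ∧ LiouvilleShiftedTables.PairsToGHL) :=
  Iff.rfl

/-! ## §1 Card A — the hinge adapter (conjunct 4 on the sibling's rails) -/

/-- **Adapter.** `LambdaLiouvilleLevel` (all residues, all heights, every `A`, level `N^{ε₀}`) at the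
shift `−h`, specialised to the residue `h mod q` and the common height `⌊X⌋₊`, is the `ℓ¹`-level
hypothesis of the tree's hinge theorem `MAvg_of_sum_abs_vonMangoldt_mul_liouville_progressions_le`
(with `ε = ε₀/4`, `A = 6`).  The terms `n ≤ h` vanish (`λ(0) = 0`), `Int.toNat (n − h) = n − h`,
`X^{ε₀/2} ≤ ⌊X⌋₊^{ε₀}` and `log ⌊X⌋₊ ≥ (log X)/2` for `X ≥ 16`. -/
theorem hingeHyp_of_level (hL : LambdaLiouvilleLevel) :
    ∀ h : ℕ, 1 ≤ h → ∃ ε : ℝ, 0 < ε ∧ ∃ A : ℝ, 5 < A ∧ ∃ C X₀ : ℝ, ∀ X : ℝ, X₀ ≤ X →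
      ∑ q ∈ Icc 1 ⌊X ^ (2 * ε)⌋₊,
          |∑ n ∈ (Ioc h ⌊X⌋₊).filter (fun n => n ≡ h [MOD q]), Λ n * (liouville (n - h) : ℝ)|
        ≤ C * X / Real.log X ^ A := by
  intro h hh
  have hh0 : (-(h : ℤ)) ≠ 0 := by
    have : (h : ℤ) ≠ 0 := by exact_mod_cast (by omega : h ≠ 0)
    exact neg_ne_zero.mpr this
  obtain ⟨ε₀, hε₀, hA⟩ := hL (-(h : ℤ)) hh0
  obtain ⟨C, N₀, hC⟩ := hA 6 (by norm_num)
  refine ⟨ε₀ / 4, by positivity, 6, by norm_num, |C| * 2 ^ 6, (N₀ : ℝ) + 16, ?_⟩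
  intro X hX
  have hX16 : (16 : ℝ) ≤ X := le_trans (by simp) hX
  have hX0 : 0 < X := by linarith
  have hX1 : 1 < X := by linarith
  set N : ℕ := ⌊X⌋₊ with hNdef
  have hNX : (N : ℝ) ≤ X := Nat.floor_le hX0.le
  have hN0 : N₀ ≤ N := Nat.le_floor (by linarith)
  -- `√X ≤ N`
  have hs0 : 0 ≤ Real.sqrt X := Real.sqrt_nonneg X
  have hsX : Real.sqrt X * Real.sqrt X = X := Real.mul_self_sqrt hX0.le
  have h2s : (2 : ℝ) ≤ Real.sqrt X := by
    have h4 : Real.sqrt 4 = 2 := by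
      rw [show (4 : ℝ) = 2 ^ 2 by norm_num, Real.sqrt_sq (by norm_num)]
    rw [← h4]
    exact Real.sqrt_le_sqrt (by linarith)
  have hsN : Real.sqrt X ≤ N := by
    have hlt : X < (N : ℝ) + 1 := Nat.lt_floor_add_one X
    nlinarith
  have hN1 : (1 : ℝ) < N := by linarith
  have hNpos : (0 : ℝ) < N := by linarith
  -- the level statement at shift `-h`, residue `h`, height `N`
  have key := hC N hN0 (fun _ => h) (fun _ => N) (fun _ => le_rfl)
  -- (1) the inner sums agree
  have inner : ∀ q : ℕ,
      ∑ n ∈ (Ioc h N).filter (fun n => n ≡ h [MOD q]), Λ n * (liouville (n - h) : ℝ) =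
        ∑ n ∈ (Icc 1 N).filter (fun n : ℕ => n ≡ h [MOD q]),
          Λ n * (liouville (Int.toNat ((n : ℤ) + -(h : ℤ))) : ℝ) := by
    intro q
    have hsub : (Ioc h N).filter (fun n => n ≡ h [MOD q]) ⊆
        (Icc 1 N).filter (fun n : ℕ => n ≡ h [MOD q]) := by
      apply Finset.filter_subset_filter
      intro n hn
      simp only [Finset.mem_Ioc, Finset.mem_Icc] at hn ⊢
      omega
    rw [← Finset.sum_subset hsub]
    · refine Finset.sum_congr rfl fun n _ => ?_
      rw [← sub_eq_add_neg, Int.toNat_sub]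
    · intro n hn hn'
      have hn1 := Finset.mem_filter.mp hn
      have hle : n ≤ h := by
        by_contra hcon
        exact hn' (Finset.mem_filter.mpr
          ⟨Finset.mem_Ioc.mpr ⟨not_le.mp hcon, (Finset.mem_Icc.mp hn1.1).2⟩, hn1.2⟩)
      rw [← sub_eq_add_neg, Int.toNat_sub, Nat.sub_eq_zero_of_le hle]
      simp
  -- (2) the q-range: `⌊X^{2(ε₀/4)}⌋₊ ≤ ⌊N^{ε₀}⌋₊`
  have hrange : ⌊X ^ (2 * (ε₀ / 4))⌋₊ ≤ ⌊(N : ℝ) ^ ε₀⌋₊ := by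
    apply Nat.floor_le_floor
    have : X ^ (2 * (ε₀ / 4)) = (Real.sqrt X) ^ ε₀ := by
      rw [Real.sqrt_eq_rpow, ← Real.rpow_mul hX0.le]
      congr 1
      ring
    rw [this]
    exact Real.rpow_le_rpow hs0 hsN hε₀.le
  have step2 :
      ∑ q ∈ Icc 1 ⌊X ^ (2 * (ε₀ / 4))⌋₊,
          |∑ n ∈ (Ioc h N).filter (fun n => n ≡ h [MOD q]), Λ n * (liouville (n - h) : ℝ)| ≤
        ∑ q ∈ Icc 1 ⌊(N : ℝ) ^ ε₀⌋₊,
          |∑ n ∈ (Icc 1 N).filter (fun n : ℕ => n ≡ h [MOD q]),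
            Λ n * (liouville (Int.toNat ((n : ℤ) + -(h : ℤ))) : ℝ)| := by
    calc ∑ q ∈ Icc 1 ⌊X ^ (2 * (ε₀ / 4))⌋₊,
          |∑ n ∈ (Ioc h N).filter (fun n => n ≡ h [MOD q]), Λ n * (liouville (n - h) : ℝ)|
        = ∑ q ∈ Icc 1 ⌊X ^ (2 * (ε₀ / 4))⌋₊,
          |∑ n ∈ (Icc 1 N).filter (fun n : ℕ => n ≡ h [MOD q]),
            Λ n * (liouville (Int.toNat ((n : ℤ) + -(h : ℤ))) : ℝ)| := by
          refine Finset.sum_congr rfl fun q _ => ?_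
          rw [inner q]
      _ ≤ _ := by
          apply Finset.sum_le_sum_of_subset_of_nonneg (Finset.Icc_subset_Icc le_rfl hrange)
          intro q _ _
          exact abs_nonneg _
  -- (3) the bound
  have hlogX : 0 < Real.log X := Real.log_pos hX1
  have hlogN : Real.log X / 2 ≤ Real.log N := by
    rw [← Real.log_sqrt hX0.le]
    exact Real.log_le_log (by linarith) hsN
  have hlogN0 : 0 < Real.log N := by linarith
  calc ∑ q ∈ Icc 1 ⌊X ^ (2 * (ε₀ / 4))⌋₊,
        |∑ n ∈ (Ioc h N).filter (fun n => n ≡ h [MOD q]), Λ n * (liouville (n - h) : ℝ)|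
      ≤ C * N / Real.log N ^ (6 : ℝ) := step2.trans key
    _ ≤ |C| * N / Real.log N ^ (6 : ℝ) := by
        apply div_le_div_of_nonneg_right _ (by positivity)
        exact mul_le_mul_of_nonneg_right (le_abs_self C) (Nat.cast_nonneg N)
    _ ≤ |C| * X / Real.log N ^ (6 : ℝ) := by
        apply div_le_div_of_nonneg_right _ (by positivity)
        exact mul_le_mul_of_nonneg_left hNX (abs_nonneg C)
    _ ≤ |C| * X / (Real.log X / 2) ^ (6 : ℝ) := by
        apply div_le_div_of_nonneg_left (by positivity) (Real.rpow_pos_of_pos (by linarith) _)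
        exact Real.rpow_le_rpow (by linarith) hlogN (by norm_num)
    _ = |C| * 2 ^ 6 * X / Real.log X ^ (6 : ℝ) := by
        rw [Real.div_rpow hlogX.le (by norm_num)]
        rw [show ((2 : ℝ) ^ (6 : ℝ)) = 2 ^ 6 by norm_num]
        field_simp

/-- **Conjunct-4 hinge.** `LambdaLiouvilleLevel → MAvg` (the sibling route's terminal parity node,
item stmt-Parity-14273 = MobiusShiftedPrimes 0613), by the tree's hinge theorem. -/
theorem levelToMAvg (hL : LambdaLiouvilleLevel) : LiouvilleShiftedTables.MAvg :=
  Summit.Parity.GeneralizedHardyLittlewood.Theorems.MAvg.MAvg_of_sum_abs_vonMangoldt_mul_liouville_progressions_le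
    (hingeHyp_of_level hL)

/-- **Conjunct 4 on rails.** The sibling support item `PairsFromMAvg` (stmt-Parity-14275,
`EH → MAvg → PairsHL`) gives the crux's conjunct `LevelToPairs` (= stmt-Parity-14550); the bridge
premise `ElliottHalberstam` is `EH` by `δ`-unfolding. -/
theorem levelToPairs_of_rails (hP : LiouvilleShiftedTables.PairsFromMAvg) : LevelToPairs :=
  fun hL hEH => hP hEH (levelToMAvg hL)

/-! ## §2 Card B — class-blind Type II -/

/-- **Abstract class-blindness.** If a bilinear form obeys `|B(a, b)| ≤ K ‖a‖₂ ‖b‖₂` for all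
coefficient vectors, then for disjointly supported restrictions `a·1_{S u}`, `b·1_{T u}` (the `S u`
pairwise disjoint, the `T u` pairwise disjoint) the sum over `u` of the restricted forms obeys the
SAME bound: `|Σ_u B(a 1_{S u}, b 1_{T u})| ≤ K ‖a‖₂ ‖b‖₂` (Cauchy–Schwarz in `u` and Bessel). Stated
for finitely supported real vectors on `ℕ`. -/
theorem classBlind_abstract {ι : Type*} (U : Finset ι) (I J : Finset ℕ)
    (S T : ι → Finset ℕ) (hS : (U : Set ι).PairwiseDisjoint S) (hT : (U : Set ι).PairwiseDisjoint T)
    (B : (ℕ → ℝ) → (ℕ → ℝ) → ℝ) (K : ℝ) (hK : 0 ≤ K)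
    (hB : ∀ a b : ℕ → ℝ, |B a b| ≤ K * Real.sqrt (∑ m ∈ I, a m ^ 2) * Real.sqrt (∑ n ∈ J, b n ^ 2))
    (a b : ℕ → ℝ) :
    |∑ u ∈ U, B (fun m => if m ∈ S u then a m else 0) (fun n => if n ∈ T u then b n else 0)| ≤
      K * Real.sqrt (∑ m ∈ I, a m ^ 2) * Real.sqrt (∑ n ∈ J, b n ^ 2) := by
  classical
  -- restricted norms
  set A : ι → ℝ := fun u => Real.sqrt (∑ m ∈ I, (if m ∈ S u then a m else 0) ^ 2) with hAdef
  set Bn : ι → ℝ := fun u => Real.sqrt (∑ n ∈ J, (if n ∈ T u then b n else 0) ^ 2) with hBdef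
  have h1 : |∑ u ∈ U, B (fun m => if m ∈ S u then a m else 0) (fun n => if n ∈ T u then b n else 0)|
      ≤ ∑ u ∈ U, K * A u * Bn u := by
    refine (Finset.abs_sum_le_sum_abs _ _).trans (Finset.sum_le_sum fun u _ => ?_)
    exact hB _ _
  -- Bessel: `Σ_u A u ^ 2 ≤ Σ_m a m ^ 2`, same for `Bn`
  have bessel : ∀ (V : ι → Finset ℕ), (U : Set ι).PairwiseDisjoint V → ∀ (c : ℕ → ℝ) (L : Finset ℕ),
      ∑ u ∈ U, (∑ m ∈ L, (if m ∈ V u then c m else 0) ^ 2) ≤ ∑ m ∈ L, c m ^ 2 := by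
    intro V hV c L
    rw [Finset.sum_comm]
    refine Finset.sum_le_sum fun m _ => ?_
    -- at most one `u ∈ U` has `m ∈ V u`
    by_cases hm : ∃ u ∈ U, m ∈ V u
    · obtain ⟨u₀, hu₀, hmu₀⟩ := hm
      have : ∑ u ∈ U, (if m ∈ V u then c m else 0) ^ 2 = (if m ∈ V u₀ then c m else 0) ^ 2 := by
        refine Finset.sum_eq_single_of_mem u₀ hu₀ fun u hu hne => ?_
        have hdis := hV hu hu₀ hne
        have : m ∉ V u := by
          intro hmu
          exact (Finset.disjoint_left.mp hdis) hmu hmu₀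
        simp [this]
      rw [this]
      simp [hmu₀]
    · push Not at hm
      have : ∑ u ∈ U, (if m ∈ V u then c m else 0) ^ 2 = 0 :=
        Finset.sum_eq_zero fun u hu => by simp [hm u hu]
      rw [this]
      positivity
  have hA2 : ∑ u ∈ U, A u ^ 2 ≤ ∑ m ∈ I, a m ^ 2 := by
    have : ∀ u ∈ U, A u ^ 2 = ∑ m ∈ I, (if m ∈ S u then a m else 0) ^ 2 := fun u _ =>
      Real.sq_sqrt (Finset.sum_nonneg fun _ _ => sq_nonneg _)
    rw [Finset.sum_congr rfl this]
    exact bessel S hS a I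
  have hB2 : ∑ u ∈ U, Bn u ^ 2 ≤ ∑ n ∈ J, b n ^ 2 := by
    have : ∀ u ∈ U, Bn u ^ 2 = ∑ n ∈ J, (if n ∈ T u then b n else 0) ^ 2 := fun u _ =>
      Real.sq_sqrt (Finset.sum_nonneg fun _ _ => sq_nonneg _)
    rw [Finset.sum_congr rfl this]
    exact bessel T hT b J
  -- Cauchy–Schwarz in `u`
  have hCS : ∑ u ∈ U, A u * Bn u ≤ Real.sqrt (∑ u ∈ U, A u ^ 2) * Real.sqrt (∑ u ∈ U, Bn u ^ 2) := by
    have := Real.sum_mul_le_sqrt_mul_sqrt U A Bn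
    exact this
  calc |∑ u ∈ U, B (fun m => if m ∈ S u then a m else 0) (fun n => if n ∈ T u then b n else 0)|
      ≤ ∑ u ∈ U, K * A u * Bn u := h1
    _ = K * ∑ u ∈ U, A u * Bn u := by rw [Finset.mul_sum]; exact Finset.sum_congr rfl fun u _ => by ring
    _ ≤ K * (Real.sqrt (∑ u ∈ U, A u ^ 2) * Real.sqrt (∑ u ∈ U, Bn u ^ 2)) :=
        mul_le_mul_of_nonneg_left hCS hK
    _ ≤ K * (Real.sqrt (∑ m ∈ I, a m ^ 2) * Real.sqrt (∑ n ∈ J, b n ^ 2)) := by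
        apply mul_le_mul_of_nonneg_left _ hK
        exact mul_le_mul (Real.sqrt_le_sqrt hA2) (Real.sqrt_le_sqrt hB2) (Real.sqrt_nonneg _)
          (Real.sqrt_nonneg _)
    _ = K * Real.sqrt (∑ m ∈ I, a m ^ 2) * Real.sqrt (∑ n ∈ J, b n ^ 2) := by ring

/-- **Class-restricted power-saving Type II for `λ(mn + c)`** (card B; PROVED below from
`TypeIILiouville` with the constant `|C|`): the SAME bound as `TypeIILiouville`, uniformly over every
modulus `q ≥ 1` and every UNIT class `w mod q` imposed on the product `mn` (non-unit classes carry
`O(log)` prime powers on the `Λ`-side and are not needed). [this sketch] -/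
def ClassTypeII : Prop :=
  ∀ c : ℤ, c ≠ 0 → ∃ η : ℝ, 0 < η ∧ ∃ C : ℝ, ∀ M N q w : ℕ, 1 ≤ N → N ≤ M → 1 ≤ q →
    Nat.Coprime w q → ∀ α β : ℕ → ℝ,
    |∑ m ∈ Finset.Ioc M (2 * M), ∑ n ∈ Finset.Ioc N (2 * N),
        (if m * n ≡ w [MOD q] then
          α m * β n * (ArithmeticFunction.liouville (Int.toNat ((m : ℤ) * n + c)) : ℝ) else 0)| ≤
      C * Real.sqrt (∑ m ∈ Finset.Ioc M (2 * M), α m ^ 2) *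
        Real.sqrt (∑ n ∈ Finset.Ioc N (2 * N), β n ^ 2) * Real.sqrt ((M : ℝ) * N) *
        ((N : ℝ) ^ (-(1 / 2 : ℝ)) + (M : ℝ) ^ (-η))

/-- The unit `m`-classes: `m ∼ M` with `m % q = u`. [this sketch] -/
def clsS (q M u : ℕ) : Finset ℕ := (Finset.Ioc M (2 * M)).filter (fun m => m % q = u)

/-- The matching `n`-classes: `n ∼ N` with `u·n ≡ w (mod q)`. [this sketch] -/
def clsT (q N w u : ℕ) : Finset ℕ := (Finset.Ioc N (2 * N)).filter (fun n => u * n % q = w % q)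

theorem mem_clsS {q M u m : ℕ} : m ∈ clsS q M u ↔ m ∈ Finset.Ioc M (2 * M) ∧ m % q = u := by
  simp [clsS]

theorem mem_clsT {q N w u n : ℕ} :
    n ∈ clsT q N w u ↔ n ∈ Finset.Ioc N (2 * N) ∧ u * n % q = w % q := by
  simp [clsT]

/-- **First lemma of card B, PROVED**: `TypeIILiouville → ClassTypeII` — `classBlind_abstract` with
`U` = the unit residues `u mod q`, `S u = {m ∼ M : m ≡ u}`, `T u = {n ∼ N : u n ≡ w}`; for a unit
class `w` only unit `m`-classes occur and `u ↦ "n with un ≡ w"` gives pairwise disjoint `T u`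
(cancel the unit `n`), so the class-restricted double sum IS `Σ_u B(α 1_{S u}, β 1_{T u})`. -/
theorem classTypeII_of_typeII : TypeIILiouville → ClassTypeII := by
  intro hT c hc
  obtain ⟨η, hη, C, hC⟩ := hT c hc
  refine ⟨η, hη, |C|, ?_⟩
  intro M N q w hN hNM hq hw α β
  classical
  -- the unit classes
  set U : Finset ℕ := (Finset.range q).filter (fun u => Nat.Coprime u q) with hUdef
  have hqpos : 0 < q := hq
  -- disjointness of the two families
  have hS : (U : Set ℕ).PairwiseDisjoint (clsS q M) := by
    intro u _ v _ huv
    change Disjoint (clsS q M u) (clsS q M v)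
    rw [Finset.disjoint_left]
    intro m hmu hmv
    exact huv ((mem_clsS.mp hmu).2.symm.trans (mem_clsS.mp hmv).2)
  have hTd : (U : Set ℕ).PairwiseDisjoint (clsT q N w) := by
    intro u hu v hv huv
    change Disjoint (clsT q N w u) (clsT q N w v)
    rw [Finset.disjoint_left]
    intro n hnu hnv
    apply huv
    have hu' := Finset.mem_filter.mp (Finset.mem_coe.mp hu)
    have hv' := Finset.mem_filter.mp (Finset.mem_coe.mp hv)
    have e1 : u * n ≡ w [MOD q] := (mem_clsT.mp hnu).2
    have e2 : v * n ≡ w [MOD q] := (mem_clsT.mp hnv).2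
    have hnq : Nat.Coprime n q := by
      have hg : Nat.gcd (u * n) q = Nat.gcd w q := e1.gcd_eq
      have : Nat.Coprime (u * n) q := by
        rw [Nat.Coprime, hg]; exact hw
      exact Nat.Coprime.coprime_mul_left this
    have e3 : u * n ≡ v * n [MOD q] := e1.trans e2.symm
    have e4 : u ≡ v [MOD q] := Nat.ModEq.cancel_right_of_coprime
      (by rw [Nat.gcd_comm]; exact hnq) e3
    exact Nat.ModEq.eq_of_lt_of_lt e4 (Finset.mem_range.mp hu'.1) (Finset.mem_range.mp hv'.1)
  -- the bilinear form and its bound from `TypeIILiouville`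
  have hB : ∀ a b : ℕ → ℝ,
      |(fun a b : ℕ → ℝ => ∑ m ∈ Finset.Ioc M (2 * M), ∑ n ∈ Finset.Ioc N (2 * N),
          a m * b n * (ArithmeticFunction.liouville (Int.toNat ((m : ℤ) * n + c)) : ℝ)) a b| ≤
        (|C| * Real.sqrt ((M : ℝ) * N) * ((N : ℝ) ^ (-(1 / 2 : ℝ)) + (M : ℝ) ^ (-η))) *
          Real.sqrt (∑ m ∈ Finset.Ioc M (2 * M), a m ^ 2) *
          Real.sqrt (∑ n ∈ Finset.Ioc N (2 * N), b n ^ 2) := by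
    intro a b
    have h0 := hC M N hN hNM a b
    have hnn : 0 ≤ Real.sqrt (∑ m ∈ Finset.Ioc M (2 * M), a m ^ 2) *
        Real.sqrt (∑ n ∈ Finset.Ioc N (2 * N), b n ^ 2) * Real.sqrt ((M : ℝ) * N) *
        ((N : ℝ) ^ (-(1 / 2 : ℝ)) + (M : ℝ) ^ (-η)) := by positivity
    calc _ ≤ C * Real.sqrt (∑ m ∈ Finset.Ioc M (2 * M), a m ^ 2) *
          Real.sqrt (∑ n ∈ Finset.Ioc N (2 * N), b n ^ 2) * Real.sqrt ((M : ℝ) * N) *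
          ((N : ℝ) ^ (-(1 / 2 : ℝ)) + (M : ℝ) ^ (-η)) := h0
      _ = C * (Real.sqrt (∑ m ∈ Finset.Ioc M (2 * M), a m ^ 2) *
          Real.sqrt (∑ n ∈ Finset.Ioc N (2 * N), b n ^ 2) * Real.sqrt ((M : ℝ) * N) *
          ((N : ℝ) ^ (-(1 / 2 : ℝ)) + (M : ℝ) ^ (-η))) := by ring
      _ ≤ |C| * (Real.sqrt (∑ m ∈ Finset.Ioc M (2 * M), a m ^ 2) *
          Real.sqrt (∑ n ∈ Finset.Ioc N (2 * N), b n ^ 2) * Real.sqrt ((M : ℝ) * N) *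
          ((N : ℝ) ^ (-(1 / 2 : ℝ)) + (M : ℝ) ^ (-η))) :=
          mul_le_mul_of_nonneg_right (le_abs_self C) hnn
      _ = _ := by ring
  have hK : 0 ≤ |C| * Real.sqrt ((M : ℝ) * N) * ((N : ℝ) ^ (-(1 / 2 : ℝ)) + (M : ℝ) ^ (-η)) := by
    positivity
  have key := classBlind_abstract U (Finset.Ioc M (2 * M)) (Finset.Ioc N (2 * N))
    (clsS q M) (clsT q N w) hS hTd _ _ hK hB α β
  beta_reduce at key
  -- the class-restricted sum IS the sum over `u` of the restricted forms
  have hid : (∑ m ∈ Finset.Ioc M (2 * M), ∑ n ∈ Finset.Ioc N (2 * N),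
        (if m * n ≡ w [MOD q] then
          α m * β n * (ArithmeticFunction.liouville (Int.toNat ((m : ℤ) * n + c)) : ℝ) else 0)) =
      ∑ u ∈ U, ∑ m ∈ Finset.Ioc M (2 * M), ∑ n ∈ Finset.Ioc N (2 * N),
        (if m ∈ clsS q M u then α m else 0) * (if n ∈ clsT q N w u then β n else 0) *
          (ArithmeticFunction.liouville (Int.toNat ((m : ℤ) * n + c)) : ℝ) := by
    symm
    rw [Finset.sum_comm]
    refine Finset.sum_congr rfl fun m hm => ?_
    rw [Finset.sum_comm]
    refine Finset.sum_congr rfl fun n hn => ?_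
    by_cases hmn : m * n ≡ w [MOD q]
    · rw [if_pos hmn]
      -- the unique class is `u₀ = m % q`
      have hmq : Nat.Coprime m q := by
        have hg : Nat.gcd (m * n) q = Nat.gcd w q := hmn.gcd_eq
        have : Nat.Coprime (m * n) q := by rw [Nat.Coprime, hg]; exact hw
        exact Nat.Coprime.coprime_mul_right this
      have hu0 : m % q ∈ U := by
        refine Finset.mem_filter.mpr ⟨Finset.mem_range.mpr (Nat.mod_lt _ hqpos), ?_⟩
        show Nat.gcd (m % q) q = 1
        rw [← Nat.gcd_rec, Nat.gcd_comm]
        exact hmq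
      rw [Finset.sum_eq_single_of_mem (m % q) hu0]
      · have h1 : m ∈ clsS q M (m % q) := mem_clsS.mpr ⟨hm, rfl⟩
        have h2 : n ∈ clsT q N w (m % q) := by
          refine mem_clsT.mpr ⟨hn, ?_⟩
          rw [Nat.mod_mul_mod]
          exact hmn
        rw [if_pos h1, if_pos h2]
      · intro u _ hne
        have : m ∉ clsS q M u := fun h => hne (mem_clsS.mp h).2.symm
        rw [if_neg this]
        ring
    · rw [if_neg hmn]
      refine Finset.sum_eq_zero fun u _ => ?_
      by_cases h1 : m ∈ clsS q M u
      · have h2 : n ∉ clsT q N w u := by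
          intro h2
          apply hmn
          have e1 := (mem_clsS.mp h1).2
          have e2 := (mem_clsT.mp h2).2
          change m * n % q = w % q
          rw [← Nat.mod_mul_mod, e1]
          exact e2
        rw [if_neg h2]
        ring
      · rw [if_neg h1]
        ring
  rw [hid]
  calc _ ≤ _ := key
    _ = _ := by ring

/-! ## §3 The crux modulo the named residual -/

/-- **EngineToGHL on rails.** Conjuncts 1–3 as their own support items (13321, 13323: candidate
proofs attached; 14996: card B), conjunct 4 from the sibling item `PairsFromMAvg` (14275) through the
adapter, conjunct 5 = the shared residual `PairsToGHL` (stmt-Parity-9389, held behind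
`DicksonFibration.DimOne` stmt-Parity-0819) BY NAME. Pure logic. -/
theorem engineToGHL_of_rails (g₁ : DecorrelationToDilatedChowla) (g₂ : DilatedChowlaToTypeII)
    (g₃ : TypeIIToLevel) (hP : LiouvilleShiftedTables.PairsFromMAvg)
    (r : LiouvilleShiftedTables.PairsToGHL) : EngineToGHL :=
  ⟨g₁, g₂, g₃, levelToPairs_of_rails hP, r⟩

/-- The same with the sibling's GLUE crux `EngineToPairs` route: once `TypeIIToLevel` and
`PairsFromMAvg` are theorems, `EngineToGHL ↔ PairsToGHL` given the two S-sized supports. -/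
theorem engineToGHL_iff_pairsToGHL (g₁ : DecorrelationToDilatedChowla) (g₂ : DilatedChowlaToTypeII)
    (g₃ : TypeIIToLevel) (hP : LiouvilleShiftedTables.PairsFromMAvg) :
    EngineToGHL ↔ LiouvilleShiftedTables.PairsToGHL :=
  ⟨fun hX => hX.2.2.2.2, fun r => engineToGHL_of_rails g₁ g₂ g₃ hP r⟩

end Summit.Parity.GeneralizedHardyLittlewood.Cruxes.EngineToGHL.Ideator2

end
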